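import Mathlib
import Summits.ValiantsHypothesis.ValiantsHypothesis.Theorems.KPlusLogSqLawStepFourInf
import Summits.ValiantsHypothesis.ValiantsHypothesis.Theorems.KPlusLogSqLawStepSlopes
import Summits.ValiantsHypothesis.ValiantsHypothesis.Theorems.KPlusLogSqLawStepLength

/-!
# The FOUR-STEP LAW and the PLATEAU LENGTH LAW `k ≤ d + 2` (static path model behind `KPlusLogSqLaw.TropicalB`)

Cell pub-symmetroid, seat conjb-2 (g23). A helper toward the crux `TropicalB`
(`Summit.ValiantsHypothesis.ValiantsHypothesis.Theses.KPlusLogSqLaw.TropicalB`, item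
`stmt-ValiantsHypothesis-19771`); it earns no crux credit and is not evidence for `MatrixDescartes` or for
Valiant's hypothesis.

SETTING as in `KPlusLogSqLawStepFourLook` / `KPlusLogSqLawStepFourInf` (abstract upper class `up`, lines
`S_t(θ) = b t + s t * θ`, windows `[i+k, i+d+k]`, separation sets `T[u, v]`, rows step / move right / move left) and,
for the parity model of `KPlusLogSqLawStepLength`, even lines above odd lines.

CONTENT.
* `four_mid_rl` — FOUR-STEP LAW, middle pattern `(R, L)`: if rows `i, …, i+3` (reach `d ≥ 3`) step, with the class
  pattern `up i`, `¬ up (i+1)`, `up (i+2)`, `¬ up (i+3)`, `up (i+4)`, `up (i+d+1)`, `¬ up (i+d+2)`, `up (i+d+3)`,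
  `¬ up (i+d+4)` and rows `i`, `i+3` moving either way, then rows `i+1`, `i+2` cannot move right then left
  (dispatch to `four_lrl` / `four_rlr` / `four_rrll`).
* `four_law` — both middle patterns `(R, L)` and `(L, R)` are impossible; the second by the reflection
  `θ ↦ -θ`, `s ↦ -s` (lemmas `refl_to` / `refl_of`), which keeps the classes and reverses every direction.
* `four_step_law` — the same in the PARITY MODEL and in exactly the window shape consumed by
  `KPlusLogSqLawStepLength.consecutive_steps_le_of_four` (hypothesis `hF` there): for odd `d ≥ 3`, from the
  separation of the windows `i, …, i+4` and the stepping of rows `i, …, i+3` alone. Even first line `i`: `up := Even`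
  (`par_to` / `par_of`); odd `i`: `up := Odd` on the negated lines `-S_t` (`qar_to` / `qar_of`); the outer rows'
  directions come from `KPlusLogSqLawStepSlopes.step_slopes_even` / `step_slopes_odd`.
* `consecutive_steps_le` — PLATEAU LENGTH LAW, unconditional form: along a run of windows `a, …, a+k` of odd reach
  `d ≥ 3`, each separated somewhere, consecutive ones never at a common point, with `s (a+d+1) ≠ s (a+d+2)`, one has
  `k ≤ d + 2` (`consecutive_steps_le_of_four` with `hF` discharged by `four_step_law`).
-/

set_option linter.dupNamespace false

namespace Summit.ValiantsHypothesis.ValiantsHypothesis.Theorems.KPlusLogSqLawStepFourLaw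

open Summit.ValiantsHypothesis.ValiantsHypothesis.Theorems.KPlusLogSqLawStepFourLook (four_lrl four_rlr)
open Summit.ValiantsHypothesis.ValiantsHypothesis.Theorems.KPlusLogSqLawStepFourInf (four_rrll)
open Summit.ValiantsHypothesis.ValiantsHypothesis.Theorems.KPlusLogSqLawStepSlopes (step_slopes_even step_slopes_odd)
open Summit.ValiantsHypothesis.ValiantsHypothesis.Theorems.KPlusLogSqLawStepLength
  (sep_cast consecutive_steps_le_of_four)

/-- FOUR-STEP LAW, middle pattern `(R, L)`: rows `i, …, i+3` step, row `i+1` moves right and row `i+2` moves left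
(rows `i`, `i+3` either way) — impossible. -/
theorem four_mid_rl (up : ℕ → Prop) (s b : ℕ → ℝ) (i d : ℕ) (hd : 3 ≤ d) (hup0 : up i) (hlow1 : ¬ up (i + 1))
    (hup2 : up (i + 2)) (hlow3 : ¬ up (i + 3)) (hup4 : up (i + 4)) (hup1 : up (i + d + 1))
    (hlow2 : ¬ up (i + d + 2)) (hup3 : up (i + d + 3)) (hlow4 : ¬ up (i + d + 4))
    (hA0 : ∃ θ : ℝ, (∀ e o : ℕ, i ≤ e → e ≤ i + d → i ≤ o → o ≤ i + d → up e → ¬ up o → b o + s o * θ < b e + s e * θ)) (hA1 : ∃ θ : ℝ,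
          (∀ e o : ℕ, i + 1 ≤ e → e ≤ i + d + 1 → i + 1 ≤ o → o ≤ i + d + 1 → up e → ¬ up o → b o + s o * θ < b e + s e * θ))
    (hA2 : ∃ θ : ℝ, (∀ e o : ℕ, i + 2 ≤ e → e ≤ i + d + 2 → i + 2 ≤ o → o ≤ i + d + 2 → up e → ¬ up o → b o + s o * θ < b e + s e * θ)) (hA3 : ∃ θ : ℝ,
          (∀ e o : ℕ, i + 3 ≤ e → e ≤ i + d + 3 → i + 3 ≤ o → o ≤ i + d + 3 → up e → ¬ up o → b o + s o * θ < b e + s e * θ))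
    (hA4 : ∃ θ : ℝ, (∀ e o : ℕ, i + 4 ≤ e → e ≤ i + d + 4 → i + 4 ≤ o → o ≤ i + d + 4 → up e → ¬ up o → b o + s o * θ < b e + s e * θ))
    (hdis0 : ∀ θ : ℝ, ¬ ((∀ e o : ℕ, i ≤ e → e ≤ i + d → i ≤ o → o ≤ i + d → up e → ¬ up o → b o + s o * θ < b e + s e * θ) ∧
          (∀ e o : ℕ, i + 1 ≤ e → e ≤ i + d + 1 → i + 1 ≤ o → o ≤ i + d + 1 → up e → ¬ up o → b o + s o * θ < b e + s e * θ)))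
    (hdis1 : ∀ θ : ℝ, ¬ ((∀ e o : ℕ, i + 1 ≤ e → e ≤ i + d + 1 → i + 1 ≤ o → o ≤ i + d + 1 → up e → ¬ up o → b o + s o * θ < b e + s e * θ) ∧
          (∀ e o : ℕ, i + 2 ≤ e → e ≤ i + d + 2 → i + 2 ≤ o → o ≤ i + d + 2 → up e → ¬ up o → b o + s o * θ < b e + s e * θ)))
    (hdis2 : ∀ θ : ℝ, ¬ ((∀ e o : ℕ, i + 2 ≤ e → e ≤ i + d + 2 → i + 2 ≤ o → o ≤ i + d + 2 → up e → ¬ up o → b o + s o * θ < b e + s e * θ) ∧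
          (∀ e o : ℕ, i + 3 ≤ e → e ≤ i + d + 3 → i + 3 ≤ o → o ≤ i + d + 3 → up e → ¬ up o → b o + s o * θ < b e + s e * θ)))
    (hdis3 : ∀ θ : ℝ, ¬ ((∀ e o : ℕ, i + 3 ≤ e → e ≤ i + d + 3 → i + 3 ≤ o → o ≤ i + d + 3 → up e → ¬ up o → b o + s o * θ < b e + s e * θ) ∧
          (∀ e o : ℕ, i + 4 ≤ e → e ≤ i + d + 4 → i + 4 ≤ o → o ≤ i + d + 4 → up e → ¬ up o → b o + s o * θ < b e + s e * θ)))
    (hdir0 : (∀ θ θ' : ℝ, (∀ e o : ℕ, i ≤ e → e ≤ i + d → i ≤ o → o ≤ i + d → up e → ¬ up o → b o + s o * θ < b e + s e * θ) →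
          (∀ e o : ℕ, i + 1 ≤ e → e ≤ i + d + 1 → i + 1 ≤ o → o ≤ i + d + 1 → up e → ¬ up o → b o + s o * θ' < b e + s e * θ') → θ < θ') ∨
      (∀ θ θ' : ℝ, (∀ e o : ℕ, i ≤ e → e ≤ i + d → i ≤ o → o ≤ i + d → up e → ¬ up o → b o + s o * θ < b e + s e * θ) →
            (∀ e o : ℕ, i + 1 ≤ e → e ≤ i + d + 1 → i + 1 ≤ o → o ≤ i + d + 1 → up e → ¬ up o → b o + s o * θ' < b e + s e * θ') → θ' < θ))
    (hR1 : ∀ θ θ' : ℝ, (∀ e o : ℕ, i + 1 ≤ e → e ≤ i + d + 1 → i + 1 ≤ o → o ≤ i + d + 1 → up e → ¬ up o → b o + s o * θ < b e + s e * θ) →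
          (∀ e o : ℕ, i + 2 ≤ e → e ≤ i + d + 2 → i + 2 ≤ o → o ≤ i + d + 2 → up e → ¬ up o → b o + s o * θ' < b e + s e * θ') → θ < θ')
    (hL2 : ∀ θ θ' : ℝ, (∀ e o : ℕ, i + 2 ≤ e → e ≤ i + d + 2 → i + 2 ≤ o → o ≤ i + d + 2 → up e → ¬ up o → b o + s o * θ < b e + s e * θ) →
          (∀ e o : ℕ, i + 3 ≤ e → e ≤ i + d + 3 → i + 3 ≤ o → o ≤ i + d + 3 → up e → ¬ up o → b o + s o * θ' < b e + s e * θ') → θ' < θ)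
    (hdir3 : (∀ θ θ' : ℝ, (∀ e o : ℕ, i + 3 ≤ e → e ≤ i + d + 3 → i + 3 ≤ o → o ≤ i + d + 3 → up e → ¬ up o → b o + s o * θ < b e + s e * θ) →
          (∀ e o : ℕ, i + 4 ≤ e → e ≤ i + d + 4 → i + 4 ≤ o → o ≤ i + d + 4 → up e → ¬ up o → b o + s o * θ' < b e + s e * θ') → θ < θ') ∨
      (∀ θ θ' : ℝ, (∀ e o : ℕ, i + 3 ≤ e → e ≤ i + d + 3 → i + 3 ≤ o → o ≤ i + d + 3 → up e → ¬ up o → b o + s o * θ < b e + s e * θ) →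
            (∀ e o : ℕ, i + 4 ≤ e → e ≤ i + d + 4 → i + 4 ≤ o → o ≤ i + d + 4 → up e → ¬ up o → b o + s o * θ' < b e + s e * θ') → θ' < θ)) : False := by
  rcases hdir0 with hR0 | hL0
  · rcases hdir3 with hR3 | hL3
    · exact four_rlr up s b i d hd hlow1 hup2 hlow3 hup4 hup1 hlow2 hup3 hlow4 hA0 hA1 hA2 hA3 hA4 hdis0 hdis1 hdis2
        hdis3 (Or.inl hR0) hR1 hL2 hR3
    · exact four_rrll up s b i d hd hup0 hlow1 hup2 hlow3 hup1 hlow2 hup3 hlow4 hA0 hA1 hA2 hA3 hA4 hdis0 hdis1 hdis2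
        hdis3 hR0 hR1 hL2 hL3
  · exact four_lrl up s b i d hd hlow1 hup2 hlow3 hup1 hlow2 hup3 hlow4 hA0 hA1 hA2 hA3 hA4 hdis0 hdis1 hdis2 hdis3
      hL0 hR1 hL2 hdir3

/-- Reflection `θ ↦ -θ`, `s ↦ -s`, forward: `[lo, hi]` separated at `θ` for the lines `(s, b)` is `[lo, hi]` separated
at `-θ` for the lines `(-s, b)`. -/
theorem refl_to (up : ℕ → Prop) (s b : ℕ → ℝ) (lo hi : ℕ) (θ : ℝ)
    (h : (∀ e o : ℕ, lo ≤ e → e ≤ hi → lo ≤ o → o ≤ hi → up e → ¬ up o → b o + s o * θ < b e + s e * θ)) :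
    (∀ e o : ℕ, lo ≤ e → e ≤ hi → lo ≤ o → o ≤ hi → up e → ¬ up o → b o + -s o * -θ < b e + -s e * -θ) := by
  intro e o g1 g2 g3 g4 he ho
  have key := h e o g1 g2 g3 g4 he ho
  have e1 : b o + -s o * -θ = b o + s o * θ := by ring
  have e2 : b e + -s e * -θ = b e + s e * θ := by ring
  rw [e1, e2]
  exact key

/-- Reflection `θ ↦ -θ`, `s ↦ -s`, backward. -/
theorem refl_of (up : ℕ → Prop) (s b : ℕ → ℝ) (lo hi : ℕ) (θ : ℝ)
    (h : (∀ e o : ℕ, lo ≤ e → e ≤ hi → lo ≤ o → o ≤ hi → up e → ¬ up o → b o + -s o * θ < b e + -s e * θ)) :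
    (∀ e o : ℕ, lo ≤ e → e ≤ hi → lo ≤ o → o ≤ hi → up e → ¬ up o → b o + s o * -θ < b e + s e * -θ) := by
  intro e o g1 g2 g3 g4 he ho
  have key := h e o g1 g2 g3 g4 he ho
  have e1 : b o + s o * -θ = b o + -s o * θ := by ring
  have e2 : b e + s e * -θ = b e + -s e * θ := by ring
  rw [e1, e2]
  exact key

/-- FOUR-STEP LAW (abstract classes): if rows `i, …, i+3` of reach `d ≥ 3` step (class pattern as in `four_mid_rl`,
rows `i`, `i+3` moving either way), the two middle rows `i+1`, `i+2` move the same way. -/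
theorem four_law (up : ℕ → Prop) (s b : ℕ → ℝ) (i d : ℕ) (hd : 3 ≤ d) (hup0 : up i) (hlow1 : ¬ up (i + 1))
    (hup2 : up (i + 2)) (hlow3 : ¬ up (i + 3)) (hup4 : up (i + 4)) (hup1 : up (i + d + 1))
    (hlow2 : ¬ up (i + d + 2)) (hup3 : up (i + d + 3)) (hlow4 : ¬ up (i + d + 4))
    (hA0 : ∃ θ : ℝ, (∀ e o : ℕ, i ≤ e → e ≤ i + d → i ≤ o → o ≤ i + d → up e → ¬ up o → b o + s o * θ < b e + s e * θ)) (hA1 : ∃ θ : ℝ,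
          (∀ e o : ℕ, i + 1 ≤ e → e ≤ i + d + 1 → i + 1 ≤ o → o ≤ i + d + 1 → up e → ¬ up o → b o + s o * θ < b e + s e * θ))
    (hA2 : ∃ θ : ℝ, (∀ e o : ℕ, i + 2 ≤ e → e ≤ i + d + 2 → i + 2 ≤ o → o ≤ i + d + 2 → up e → ¬ up o → b o + s o * θ < b e + s e * θ)) (hA3 : ∃ θ : ℝ,
          (∀ e o : ℕ, i + 3 ≤ e → e ≤ i + d + 3 → i + 3 ≤ o → o ≤ i + d + 3 → up e → ¬ up o → b o + s o * θ < b e + s e * θ))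
    (hA4 : ∃ θ : ℝ, (∀ e o : ℕ, i + 4 ≤ e → e ≤ i + d + 4 → i + 4 ≤ o → o ≤ i + d + 4 → up e → ¬ up o → b o + s o * θ < b e + s e * θ))
    (hdis0 : ∀ θ : ℝ, ¬ ((∀ e o : ℕ, i ≤ e → e ≤ i + d → i ≤ o → o ≤ i + d → up e → ¬ up o → b o + s o * θ < b e + s e * θ) ∧
          (∀ e o : ℕ, i + 1 ≤ e → e ≤ i + d + 1 → i + 1 ≤ o → o ≤ i + d + 1 → up e → ¬ up o → b o + s o * θ < b e + s e * θ)))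
    (hdis1 : ∀ θ : ℝ, ¬ ((∀ e o : ℕ, i + 1 ≤ e → e ≤ i + d + 1 → i + 1 ≤ o → o ≤ i + d + 1 → up e → ¬ up o → b o + s o * θ < b e + s e * θ) ∧
          (∀ e o : ℕ, i + 2 ≤ e → e ≤ i + d + 2 → i + 2 ≤ o → o ≤ i + d + 2 → up e → ¬ up o → b o + s o * θ < b e + s e * θ)))
    (hdis2 : ∀ θ : ℝ, ¬ ((∀ e o : ℕ, i + 2 ≤ e → e ≤ i + d + 2 → i + 2 ≤ o → o ≤ i + d + 2 → up e → ¬ up o → b o + s o * θ < b e + s e * θ) ∧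
          (∀ e o : ℕ, i + 3 ≤ e → e ≤ i + d + 3 → i + 3 ≤ o → o ≤ i + d + 3 → up e → ¬ up o → b o + s o * θ < b e + s e * θ)))
    (hdis3 : ∀ θ : ℝ, ¬ ((∀ e o : ℕ, i + 3 ≤ e → e ≤ i + d + 3 → i + 3 ≤ o → o ≤ i + d + 3 → up e → ¬ up o → b o + s o * θ < b e + s e * θ) ∧
          (∀ e o : ℕ, i + 4 ≤ e → e ≤ i + d + 4 → i + 4 ≤ o → o ≤ i + d + 4 → up e → ¬ up o → b o + s o * θ < b e + s e * θ)))
    (hdir0 : (∀ θ θ' : ℝ, (∀ e o : ℕ, i ≤ e → e ≤ i + d → i ≤ o → o ≤ i + d → up e → ¬ up o → b o + s o * θ < b e + s e * θ) →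
          (∀ e o : ℕ, i + 1 ≤ e → e ≤ i + d + 1 → i + 1 ≤ o → o ≤ i + d + 1 → up e → ¬ up o → b o + s o * θ' < b e + s e * θ') → θ < θ') ∨
      (∀ θ θ' : ℝ, (∀ e o : ℕ, i ≤ e → e ≤ i + d → i ≤ o → o ≤ i + d → up e → ¬ up o → b o + s o * θ < b e + s e * θ) →
            (∀ e o : ℕ, i + 1 ≤ e → e ≤ i + d + 1 → i + 1 ≤ o → o ≤ i + d + 1 → up e → ¬ up o → b o + s o * θ' < b e + s e * θ') → θ' < θ))
    (hdir3 : (∀ θ θ' : ℝ, (∀ e o : ℕ, i + 3 ≤ e → e ≤ i + d + 3 → i + 3 ≤ o → o ≤ i + d + 3 → up e → ¬ up o → b o + s o * θ < b e + s e * θ) →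
          (∀ e o : ℕ, i + 4 ≤ e → e ≤ i + d + 4 → i + 4 ≤ o → o ≤ i + d + 4 → up e → ¬ up o → b o + s o * θ' < b e + s e * θ') → θ < θ') ∨
      (∀ θ θ' : ℝ, (∀ e o : ℕ, i + 3 ≤ e → e ≤ i + d + 3 → i + 3 ≤ o → o ≤ i + d + 3 → up e → ¬ up o → b o + s o * θ < b e + s e * θ) →
            (∀ e o : ℕ, i + 4 ≤ e → e ≤ i + d + 4 → i + 4 ≤ o → o ≤ i + d + 4 → up e → ¬ up o → b o + s o * θ' < b e + s e * θ') → θ' < θ)) :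
    ¬ ((∀ θ θ' : ℝ, (∀ e o : ℕ, i + 1 ≤ e → e ≤ i + d + 1 → i + 1 ≤ o → o ≤ i + d + 1 → up e → ¬ up o → b o + s o * θ < b e + s e * θ) →
          (∀ e o : ℕ, i + 2 ≤ e → e ≤ i + d + 2 → i + 2 ≤ o → o ≤ i + d + 2 → up e → ¬ up o → b o + s o * θ' < b e + s e * θ') → θ < θ') ∧
        (∀ θ θ' : ℝ, (∀ e o : ℕ, i + 2 ≤ e → e ≤ i + d + 2 → i + 2 ≤ o → o ≤ i + d + 2 → up e → ¬ up o → b o + s o * θ < b e + s e * θ) →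
              (∀ e o : ℕ, i + 3 ≤ e → e ≤ i + d + 3 → i + 3 ≤ o → o ≤ i + d + 3 → up e → ¬ up o → b o + s o * θ' < b e + s e * θ') → θ' < θ)) ∧
      ¬ ((∀ θ θ' : ℝ, (∀ e o : ℕ, i + 1 ≤ e → e ≤ i + d + 1 → i + 1 ≤ o → o ≤ i + d + 1 → up e → ¬ up o → b o + s o * θ < b e + s e * θ) →
            (∀ e o : ℕ, i + 2 ≤ e → e ≤ i + d + 2 → i + 2 ≤ o → o ≤ i + d + 2 → up e → ¬ up o → b o + s o * θ' < b e + s e * θ') → θ' < θ) ∧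
        (∀ θ θ' : ℝ, (∀ e o : ℕ, i + 2 ≤ e → e ≤ i + d + 2 → i + 2 ≤ o → o ≤ i + d + 2 → up e → ¬ up o → b o + s o * θ < b e + s e * θ) →
              (∀ e o : ℕ, i + 3 ≤ e → e ≤ i + d + 3 → i + 3 ≤ o → o ≤ i + d + 3 → up e → ¬ up o → b o + s o * θ' < b e + s e * θ') → θ < θ')) := by
  refine ⟨fun h => four_mid_rl up s b i d hd hup0 hlow1 hup2 hlow3 hup4 hup1 hlow2 hup3 hlow4 hA0 hA1 hA2 hA3 hA4
    hdis0 hdis1 hdis2 hdis3 hdir0 h.1 h.2 hdir3, fun h => ?_⟩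
  obtain ⟨hL1, hR2⟩ := h
  -- reflect: the lines `(-s, b)` at `-θ`; classes are kept, every direction is reversed
  refine four_mid_rl up (fun t => -s t) b i d hd hup0 hlow1 hup2 hlow3 hup4 hup1 hlow2 hup3 hlow4
    (hA0.elim fun θ h => ⟨-θ, refl_to up s b _ _ θ h⟩) (hA1.elim fun θ h => ⟨-θ, refl_to up s b _ _ θ h⟩)
    (hA2.elim fun θ h => ⟨-θ, refl_to up s b _ _ θ h⟩) (hA3.elim fun θ h => ⟨-θ, refl_to up s b _ _ θ h⟩)
    (hA4.elim fun θ h => ⟨-θ, refl_to up s b _ _ θ h⟩)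
    (fun θ h => hdis0 (-θ) ⟨refl_of up s b _ _ θ h.1, refl_of up s b _ _ θ h.2⟩)
    (fun θ h => hdis1 (-θ) ⟨refl_of up s b _ _ θ h.1, refl_of up s b _ _ θ h.2⟩)
    (fun θ h => hdis2 (-θ) ⟨refl_of up s b _ _ θ h.1, refl_of up s b _ _ θ h.2⟩)
    (fun θ h => hdis3 (-θ) ⟨refl_of up s b _ _ θ h.1, refl_of up s b _ _ θ h.2⟩)
    ?_ ?_ ?_ ?_
  · rcases hdir0 with hR0 | hL0
    · refine Or.inr fun θ θ' h h' => ?_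
      have := hR0 (-θ) (-θ') (refl_of up s b _ _ θ h) (refl_of up s b _ _ θ' h')
      linarith
    · refine Or.inl fun θ θ' h h' => ?_
      have := hL0 (-θ) (-θ') (refl_of up s b _ _ θ h) (refl_of up s b _ _ θ' h')
      linarith
  · intro θ θ' h h'
    have := hL1 (-θ) (-θ') (refl_of up s b _ _ θ h) (refl_of up s b _ _ θ' h')
    linarith
  · intro θ θ' h h'
    have := hR2 (-θ) (-θ') (refl_of up s b _ _ θ h) (refl_of up s b _ _ θ' h')
    linarith
  · rcases hdir3 with hR3 | hL3
    · refine Or.inr fun θ θ' h h' => ?_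
      have := hR3 (-θ) (-θ') (refl_of up s b _ _ θ h) (refl_of up s b _ _ θ' h')
      linarith
    · refine Or.inl fun θ θ' h h' => ?_
      have := hL3 (-θ) (-θ') (refl_of up s b _ _ θ h) (refl_of up s b _ _ θ' h')
      linarith

/-- Parity model, even lines above: transport to the abstract class `up := Even` (with re-bracketing). -/
theorem par_to (s b : ℕ → ℝ) (lo hi lo' hi' : ℕ) (h1 : lo = lo') (h2 : hi = hi') (θ : ℝ)
    (h : (∀ e o : ℕ, lo ≤ e → e ≤ hi → lo ≤ o → o ≤ hi → Even e → Odd o → b o + s o * θ < b e + s e * θ)) :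
    (∀ e o : ℕ, lo' ≤ e → e ≤ hi' → lo' ≤ o → o ≤ hi' → Even e → ¬ Even o → b o + s o * θ < b e + s e * θ) := by
  intro e o g1 g2 g3 g4 he ho
  exact h e o (by omega) (by omega) (by omega) (by omega) he (Nat.not_even_iff_odd.mp ho)

/-- Parity model, even lines above: transport from the abstract class `up := Even` (with re-bracketing). -/
theorem par_of (s b : ℕ → ℝ) (lo hi lo' hi' : ℕ) (h1 : lo = lo') (h2 : hi = hi') (θ : ℝ)
    (h : (∀ e o : ℕ, lo ≤ e → e ≤ hi → lo ≤ o → o ≤ hi → Even e → ¬ Even o → b o + s o * θ < b e + s e * θ)) :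
    (∀ e o : ℕ, lo' ≤ e → e ≤ hi' → lo' ≤ o → o ≤ hi' → Even e → Odd o → b o + s o * θ < b e + s e * θ) := by
  intro e o g1 g2 g3 g4 he ho
  exact h e o (by omega) (by omega) (by omega) (by omega) he (Nat.not_even_iff_odd.mpr ho)

/-- Parity model, even lines above: transport to the abstract class `up := Odd` on the negated lines `-S_t`. -/
theorem qar_to (s b : ℕ → ℝ) (lo hi lo' hi' : ℕ) (h1 : lo = lo') (h2 : hi = hi') (θ : ℝ)
    (h : (∀ e o : ℕ, lo ≤ e → e ≤ hi → lo ≤ o → o ≤ hi → Even e → Odd o → b o + s o * θ < b e + s e * θ)) :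
    (∀ e o : ℕ, lo' ≤ e → e ≤ hi' → lo' ≤ o → o ≤ hi' → Odd e → ¬ Odd o → -b o + -s o * θ < -b e + -s e * θ) := by
  intro e o g1 g2 g3 g4 he ho
  have := h o e (by omega) (by omega) (by omega) (by omega) (Nat.not_odd_iff_even.mp ho) he
  linarith

/-- Parity model, even lines above: transport from the abstract class `up := Odd` on the negated lines `-S_t`. -/
theorem qar_of (s b : ℕ → ℝ) (lo hi lo' hi' : ℕ) (h1 : lo = lo') (h2 : hi = hi') (θ : ℝ)
    (h : (∀ e o : ℕ, lo ≤ e → e ≤ hi → lo ≤ o → o ≤ hi → Odd e → ¬ Odd o → -b o + -s o * θ < -b e + -s e * θ)) :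
    (∀ e o : ℕ, lo' ≤ e → e ≤ hi' → lo' ≤ o → o ≤ hi' → Even e → Odd o → b o + s o * θ < b e + s e * θ) := by
  intro e o g1 g2 g3 g4 he ho
  have := h o e (by omega) (by omega) (by omega) (by omega) ho (Nat.not_odd_iff_even.mpr he)
  linarith

/-- FOUR-STEP LAW in the parity model (even lines above odd lines), in the window shape of the hypothesis `hF` of
`KPlusLogSqLawStepLength.consecutive_steps_le_of_four`: if `d ≥ 3` is odd, the windows `j = i, …, i+4` (`[j, j+d]`)
are each separated somewhere and consecutive ones never at a common point, then the middle rows `i+1`, `i+2` do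
not move right-then-left nor left-then-right. -/
theorem four_step_law (s b : ℕ → ℝ) (i d : ℕ) (hd : Odd d) (hd3 : 3 ≤ d)
    (hsep : ∀ j : ℕ, i ≤ j → j ≤ i + 4 → ∃ θ : ℝ, (∀ e o : ℕ, j ≤ e → e ≤ j + d → j ≤ o → o ≤ j + d → Even e → Odd o → b o + s o * θ < b e + s e * θ))
    (hdis : ∀ j : ℕ, i ≤ j → j < i + 4 → ∀ x : ℝ, ¬ ((∀ e o : ℕ, j ≤ e → e ≤ j + d → j ≤ o → o ≤ j + d → Even e → Odd o → b o + s o * x < b e + s e * x) ∧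
          (∀ e o : ℕ, j + 1 ≤ e → e ≤ j + 1 + d → j + 1 ≤ o → o ≤ j + 1 + d → Even e → Odd o → b o + s o * x < b e + s e * x))) :
    ¬ ((∀ θ θ' : ℝ, (∀ e o : ℕ, i + 1 ≤ e → e ≤ i + 1 + d → i + 1 ≤ o → o ≤ i + 1 + d → Even e → Odd o → b o + s o * θ < b e + s e * θ) →
          (∀ e o : ℕ, i + 2 ≤ e → e ≤ i + 2 + d → i + 2 ≤ o → o ≤ i + 2 + d → Even e → Odd o → b o + s o * θ' < b e + s e * θ') → θ < θ') ∧
        (∀ θ θ' : ℝ, (∀ e o : ℕ, i + 2 ≤ e → e ≤ i + 2 + d → i + 2 ≤ o → o ≤ i + 2 + d → Even e → Odd o → b o + s o * θ < b e + s e * θ) →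
              (∀ e o : ℕ, i + 3 ≤ e → e ≤ i + 3 + d → i + 3 ≤ o → o ≤ i + 3 + d → Even e → Odd o → b o + s o * θ' < b e + s e * θ') → θ' < θ)) ∧
      ¬ ((∀ θ θ' : ℝ, (∀ e o : ℕ, i + 1 ≤ e → e ≤ i + 1 + d → i + 1 ≤ o → o ≤ i + 1 + d → Even e → Odd o → b o + s o * θ < b e + s e * θ) →
            (∀ e o : ℕ, i + 2 ≤ e → e ≤ i + 2 + d → i + 2 ≤ o → o ≤ i + 2 + d → Even e → Odd o → b o + s o * θ' < b e + s e * θ') → θ' < θ) ∧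
        (∀ θ θ' : ℝ, (∀ e o : ℕ, i + 2 ≤ e → e ≤ i + 2 + d → i + 2 ≤ o → o ≤ i + 2 + d → Even e → Odd o → b o + s o * θ < b e + s e * θ) →
              (∀ e o : ℕ, i + 3 ≤ e → e ≤ i + 3 + d → i + 3 ≤ o → o ≤ i + 3 + d → Even e → Odd o → b o + s o * θ' < b e + s e * θ') → θ < θ')) := by
  have hd2 := Nat.odd_iff.mp hd
  -- the stepping data of rows `i` and `i+3` in the shape of `KPlusLogSqLawStepSlopes`
  have hB0 : ∃ θ : ℝ, (∀ e o : ℕ, i + 1 ≤ e → e ≤ i + d + 1 → i + 1 ≤ o → o ≤ i + d + 1 → Even e → Odd o → b o + s o * θ < b e + s e * θ) := by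
    obtain ⟨θ, h⟩ := hsep (i + 1) (by omega) (by omega)
    exact ⟨θ, sep_cast s b _ _ _ _ rfl (by omega) θ h⟩
  have hAB0 : ∀ θ : ℝ, ¬ ((∀ e o : ℕ, i ≤ e → e ≤ i + d → i ≤ o → o ≤ i + d → Even e → Odd o → b o + s o * θ < b e + s e * θ) ∧
        (∀ e o : ℕ, i + 1 ≤ e → e ≤ i + d + 1 → i + 1 ≤ o → o ≤ i + d + 1 → Even e → Odd o → b o + s o * θ < b e + s e * θ)) :=
    fun θ h => hdis i le_rfl (by omega) θ ⟨h.1, sep_cast s b _ _ _ _ rfl (by omega) θ h.2⟩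
  have hB3 : ∃ θ : ℝ, (∀ e o : ℕ, i + 3 + 1 ≤ e → e ≤ i + 3 + d + 1 → i + 3 + 1 ≤ o → o ≤ i + 3 + d + 1 → Even e → Odd o → b o + s o * θ < b e + s e * θ) := by
    obtain ⟨θ, h⟩ := hsep (i + 4) (by omega) (by omega)
    exact ⟨θ, sep_cast s b _ _ _ _ (by omega) (by omega) θ h⟩
  have hAB3 : ∀ θ : ℝ, ¬ ((∀ e o : ℕ, i + 3 ≤ e → e ≤ i + 3 + d → i + 3 ≤ o → o ≤ i + 3 + d → Even e → Odd o → b o + s o * θ < b e + s e * θ) ∧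
        (∀ e o : ℕ, i + 3 + 1 ≤ e → e ≤ i + 3 + d + 1 → i + 3 + 1 ≤ o → o ≤ i + 3 + d + 1 → Even e → Odd o → b o + s o * θ < b e + s e * θ)) :=
    fun θ h => hdis (i + 3) (by omega) (by omega) θ ⟨h.1, sep_cast s b _ _ _ _ rfl (by omega) θ h.2⟩
  rcases Nat.even_or_odd i with hi | hi
  · -- even first line: `up := Even`
    have hi2 := Nat.even_iff.mp hi
    have hi3 : Odd (i + 3) := Nat.odd_iff.mpr (by omega)
    have hdir0 : (∀ θ θ' : ℝ, (∀ e o : ℕ, i ≤ e → e ≤ i + d → i ≤ o → o ≤ i + d → Even e → ¬ Even o → b o + s o * θ < b e + s e * θ) →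
          (∀ e o : ℕ, i + 1 ≤ e → e ≤ i + d + 1 → i + 1 ≤ o → o ≤ i + d + 1 → Even e → ¬ Even o → b o + s o * θ' < b e + s e * θ') → θ < θ') ∨
        (∀ θ θ' : ℝ, (∀ e o : ℕ, i ≤ e → e ≤ i + d → i ≤ o → o ≤ i + d → Even e → ¬ Even o → b o + s o * θ < b e + s e * θ) →
              (∀ e o : ℕ, i + 1 ≤ e → e ≤ i + d + 1 → i + 1 ≤ o → o ≤ i + d + 1 → Even e → ¬ Even o → b o + s o * θ' < b e + s e * θ') → θ' < θ) := by
      obtain ⟨o, o', -, -, -, -, -, -, hdir⟩ := step_slopes_even s b i d hi hd (hsep i le_rfl (by omega)) hB0 hAB0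
      rcases hdir with ⟨-, -, hR⟩ | ⟨-, -, hL⟩
      · exact Or.inl fun θ θ' h h' =>
          hR θ θ' (par_of s b _ _ _ _ rfl rfl θ h) (par_of s b _ _ _ _ rfl rfl θ' h')
      · exact Or.inr fun θ θ' h h' =>
          hL θ θ' (par_of s b _ _ _ _ rfl rfl θ h) (par_of s b _ _ _ _ rfl rfl θ' h')
    have hdir3 : (∀ θ θ' : ℝ, (∀ e o : ℕ, i + 3 ≤ e → e ≤ i + d + 3 → i + 3 ≤ o → o ≤ i + d + 3 → Even e → ¬ Even o → b o + s o * θ < b e + s e * θ) →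
          (∀ e o : ℕ, i + 4 ≤ e → e ≤ i + d + 4 → i + 4 ≤ o → o ≤ i + d + 4 → Even e → ¬ Even o → b o + s o * θ' < b e + s e * θ') → θ < θ') ∨
        (∀ θ θ' : ℝ, (∀ e o : ℕ, i + 3 ≤ e → e ≤ i + d + 3 → i + 3 ≤ o → o ≤ i + d + 3 → Even e → ¬ Even o → b o + s o * θ < b e + s e * θ) →
              (∀ e o : ℕ, i + 4 ≤ e → e ≤ i + d + 4 → i + 4 ≤ o → o ≤ i + d + 4 → Even e → ¬ Even o → b o + s o * θ' < b e + s e * θ') → θ' < θ) := by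
      obtain ⟨o, o', -, -, -, -, -, -, hdir⟩ :=
        step_slopes_odd s b (i + 3) d hi3 hd (hsep (i + 3) (by omega) (by omega)) hB3 hAB3
      rcases hdir with ⟨-, -, hR⟩ | ⟨-, -, hL⟩
      · exact Or.inl fun θ θ' h h' =>
          hR θ θ' (par_of s b _ _ _ _ rfl (by omega) θ h) (par_of s b _ _ _ _ (by omega) (by omega) θ' h')
      · exact Or.inr fun θ θ' h h' =>
          hL θ θ' (par_of s b _ _ _ _ rfl (by omega) θ h) (par_of s b _ _ _ _ (by omega) (by omega) θ' h')
    have key := four_law Even s b i d hd3 hi (fun h => by have := Nat.even_iff.mp h; omega)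
      (Nat.even_iff.mpr (by omega)) (fun h => by have := Nat.even_iff.mp h; omega) (Nat.even_iff.mpr (by omega))
      (Nat.even_iff.mpr (by omega)) (fun h => by have := Nat.even_iff.mp h; omega) (Nat.even_iff.mpr (by omega))
      (fun h => by have := Nat.even_iff.mp h; omega)
      ((hsep i le_rfl (by omega)).imp fun θ h => par_to s b _ _ _ _ rfl rfl θ h)
      ((hsep (i + 1) (by omega) (by omega)).imp fun θ h => par_to s b _ _ _ _ rfl (by omega) θ h)
      ((hsep (i + 2) (by omega) (by omega)).imp fun θ h => par_to s b _ _ _ _ rfl (by omega) θ h)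
      ((hsep (i + 3) (by omega) (by omega)).imp fun θ h => par_to s b _ _ _ _ rfl (by omega) θ h)
      ((hsep (i + 4) (by omega) (by omega)).imp fun θ h => par_to s b _ _ _ _ rfl (by omega) θ h)
      (fun θ h => hdis i le_rfl (by omega) θ
        ⟨par_of s b _ _ _ _ rfl rfl θ h.1, par_of s b _ _ _ _ rfl (by omega) θ h.2⟩)
      (fun θ h => hdis (i + 1) (by omega) (by omega) θ
        ⟨par_of s b _ _ _ _ rfl (by omega) θ h.1, par_of s b _ _ _ _ (by omega) (by omega) θ h.2⟩)
      (fun θ h => hdis (i + 2) (by omega) (by omega) θ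
        ⟨par_of s b _ _ _ _ rfl (by omega) θ h.1, par_of s b _ _ _ _ (by omega) (by omega) θ h.2⟩)
      (fun θ h => hdis (i + 3) (by omega) (by omega) θ
        ⟨par_of s b _ _ _ _ rfl (by omega) θ h.1, par_of s b _ _ _ _ (by omega) (by omega) θ h.2⟩)
      hdir0 hdir3
    refine ⟨fun h => key.1 ⟨fun θ θ' g g' => ?_, fun θ θ' g g' => ?_⟩,
      fun h => key.2 ⟨fun θ θ' g g' => ?_, fun θ θ' g g' => ?_⟩⟩
    · exact h.1 θ θ' (par_of s b _ _ _ _ rfl (by omega) θ g) (par_of s b _ _ _ _ rfl (by omega) θ' g')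
    · exact h.2 θ θ' (par_of s b _ _ _ _ rfl (by omega) θ g) (par_of s b _ _ _ _ rfl (by omega) θ' g')
    · exact h.1 θ θ' (par_of s b _ _ _ _ rfl (by omega) θ g) (par_of s b _ _ _ _ rfl (by omega) θ' g')
    · exact h.2 θ θ' (par_of s b _ _ _ _ rfl (by omega) θ g) (par_of s b _ _ _ _ rfl (by omega) θ' g')
  · -- odd first line: `up := Odd` on the negated lines `-S_t`
    have hi2 := Nat.odd_iff.mp hi
    have hi3 : Even (i + 3) := Nat.even_iff.mpr (by omega)
    have hdir0 : (∀ θ θ' : ℝ, (∀ e o : ℕ, i ≤ e → e ≤ i + d → i ≤ o → o ≤ i + d → Odd e → ¬ Odd o → -b o + -s o * θ < -b e + -s e * θ) →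
          (∀ e o : ℕ, i + 1 ≤ e → e ≤ i + d + 1 → i + 1 ≤ o → o ≤ i + d + 1 → Odd e → ¬ Odd o → -b o + -s o * θ' < -b e + -s e * θ') → θ < θ') ∨
        (∀ θ θ' : ℝ, (∀ e o : ℕ, i ≤ e → e ≤ i + d → i ≤ o → o ≤ i + d → Odd e → ¬ Odd o → -b o + -s o * θ < -b e + -s e * θ) →
              (∀ e o : ℕ, i + 1 ≤ e → e ≤ i + d + 1 → i + 1 ≤ o → o ≤ i + d + 1 → Odd e → ¬ Odd o → -b o + -s o * θ' < -b e + -s e * θ') → θ' < θ) := by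
      obtain ⟨o, o', -, -, -, -, -, -, hdir⟩ := step_slopes_odd s b i d hi hd (hsep i le_rfl (by omega)) hB0 hAB0
      rcases hdir with ⟨-, -, hR⟩ | ⟨-, -, hL⟩
      · exact Or.inl fun θ θ' h h' =>
          hR θ θ' (qar_of s b _ _ _ _ rfl rfl θ h) (qar_of s b _ _ _ _ rfl rfl θ' h')
      · exact Or.inr fun θ θ' h h' =>
          hL θ θ' (qar_of s b _ _ _ _ rfl rfl θ h) (qar_of s b _ _ _ _ rfl rfl θ' h')
    have hdir3 : (∀ θ θ' : ℝ, (∀ e o : ℕ, i + 3 ≤ e → e ≤ i + d + 3 → i + 3 ≤ o → o ≤ i + d + 3 → Odd e → ¬ Odd o → -b o + -s o * θ < -b e + -s e * θ) →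
          (∀ e o : ℕ, i + 4 ≤ e → e ≤ i + d + 4 → i + 4 ≤ o → o ≤ i + d + 4 → Odd e → ¬ Odd o → -b o + -s o * θ' < -b e + -s e * θ') → θ < θ') ∨
        (∀ θ θ' : ℝ, (∀ e o : ℕ, i + 3 ≤ e → e ≤ i + d + 3 → i + 3 ≤ o → o ≤ i + d + 3 → Odd e → ¬ Odd o → -b o + -s o * θ < -b e + -s e * θ) →
              (∀ e o : ℕ, i + 4 ≤ e → e ≤ i + d + 4 → i + 4 ≤ o → o ≤ i + d + 4 → Odd e → ¬ Odd o → -b o + -s o * θ' < -b e + -s e * θ') → θ' < θ) := by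
      obtain ⟨o, o', -, -, -, -, -, -, hdir⟩ :=
        step_slopes_even s b (i + 3) d hi3 hd (hsep (i + 3) (by omega) (by omega)) hB3 hAB3
      rcases hdir with ⟨-, -, hR⟩ | ⟨-, -, hL⟩
      · exact Or.inl fun θ θ' h h' =>
          hR θ θ' (qar_of s b _ _ _ _ rfl (by omega) θ h) (qar_of s b _ _ _ _ (by omega) (by omega) θ' h')
      · exact Or.inr fun θ θ' h h' =>
          hL θ θ' (qar_of s b _ _ _ _ rfl (by omega) θ h) (qar_of s b _ _ _ _ (by omega) (by omega) θ' h')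
    have key := four_law Odd (fun t => -s t) (fun t => -b t) i d hd3 hi (fun h => by have := Nat.odd_iff.mp h; omega)
      (Nat.odd_iff.mpr (by omega)) (fun h => by have := Nat.odd_iff.mp h; omega) (Nat.odd_iff.mpr (by omega))
      (Nat.odd_iff.mpr (by omega)) (fun h => by have := Nat.odd_iff.mp h; omega) (Nat.odd_iff.mpr (by omega))
      (fun h => by have := Nat.odd_iff.mp h; omega)
      ((hsep i le_rfl (by omega)).imp fun θ h => qar_to s b _ _ _ _ rfl rfl θ h)
      ((hsep (i + 1) (by omega) (by omega)).imp fun θ h => qar_to s b _ _ _ _ rfl (by omega) θ h)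
      ((hsep (i + 2) (by omega) (by omega)).imp fun θ h => qar_to s b _ _ _ _ rfl (by omega) θ h)
      ((hsep (i + 3) (by omega) (by omega)).imp fun θ h => qar_to s b _ _ _ _ rfl (by omega) θ h)
      ((hsep (i + 4) (by omega) (by omega)).imp fun θ h => qar_to s b _ _ _ _ rfl (by omega) θ h)
      (fun θ h => hdis i le_rfl (by omega) θ
        ⟨qar_of s b _ _ _ _ rfl rfl θ h.1, qar_of s b _ _ _ _ rfl (by omega) θ h.2⟩)
      (fun θ h => hdis (i + 1) (by omega) (by omega) θ
        ⟨qar_of s b _ _ _ _ rfl (by omega) θ h.1, qar_of s b _ _ _ _ (by omega) (by omega) θ h.2⟩)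
      (fun θ h => hdis (i + 2) (by omega) (by omega) θ
        ⟨qar_of s b _ _ _ _ rfl (by omega) θ h.1, qar_of s b _ _ _ _ (by omega) (by omega) θ h.2⟩)
      (fun θ h => hdis (i + 3) (by omega) (by omega) θ
        ⟨qar_of s b _ _ _ _ rfl (by omega) θ h.1, qar_of s b _ _ _ _ (by omega) (by omega) θ h.2⟩)
      hdir0 hdir3
    refine ⟨fun h => key.1 ⟨fun θ θ' g g' => ?_, fun θ θ' g g' => ?_⟩,
      fun h => key.2 ⟨fun θ θ' g g' => ?_, fun θ θ' g g' => ?_⟩⟩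
    · exact h.1 θ θ' (qar_of s b _ _ _ _ rfl (by omega) θ g) (qar_of s b _ _ _ _ rfl (by omega) θ' g')
    · exact h.2 θ θ' (qar_of s b _ _ _ _ rfl (by omega) θ g) (qar_of s b _ _ _ _ rfl (by omega) θ' g')
    · exact h.1 θ θ' (qar_of s b _ _ _ _ rfl (by omega) θ g) (qar_of s b _ _ _ _ rfl (by omega) θ' g')
    · exact h.2 θ θ' (qar_of s b _ _ _ _ rfl (by omega) θ g) (qar_of s b _ _ _ _ rfl (by omega) θ' g')

/-- PLATEAU LENGTH LAW `k ≤ d + 2`, unconditional form (the four-step law `hF` of `consecutive_steps_le_of_four`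
discharged by `four_step_law`): if the windows `a, …, a+k` of odd reach `d ≥ 3` are each separated somewhere,
consecutive ones never at a common point (rows `a, …, a+k-1` step), and `s (a+d+1) ≠ s (a+d+2)`, then `k ≤ d + 2`. -/
theorem consecutive_steps_le (s b : ℕ → ℝ) (a d k : ℕ) (hd : Odd d) (hd3 : 3 ≤ d)
    (hgen : s (a + d + 1) ≠ s (a + d + 2))
    (hsep : ∀ j : ℕ, a ≤ j → j ≤ a + k → ∃ θ : ℝ, (∀ e o : ℕ, j ≤ e → e ≤ j + d → j ≤ o → o ≤ j + d → Even e → Odd o → b o + s o * θ < b e + s e * θ))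
    (hdis : ∀ j : ℕ, a ≤ j → j < a + k → ∀ x : ℝ, ¬ ((∀ e o : ℕ, j ≤ e → e ≤ j + d → j ≤ o → o ≤ j + d → Even e → Odd o → b o + s o * x < b e + s e * x) ∧
          (∀ e o : ℕ, j + 1 ≤ e → e ≤ j + 1 + d → j + 1 ≤ o → o ≤ j + 1 + d → Even e → Odd o → b o + s o * x < b e + s e * x))) :
    k ≤ d + 2 :=
  consecutive_steps_le_of_four s b a d k hd hgen hsep hdis fun i h1 h2 =>
    four_step_law s b i d hd hd3 (fun j g1 g2 => hsep j (by omega) (by omega))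
      (fun j g1 g2 => hdis j (by omega) (by omega))

end Summit.ValiantsHypothesis.ValiantsHypothesis.Theorems.KPlusLogSqLawStepFourLaw
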